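import Mathlib
import Summits.AtomisticToContinuum.Crystallization.Theorems.ExcessDecayLiouvillePhononStabilityCertGram

/-!
# Gram evaluation regrouped by slot pairs (cross-term linearity, `eval_eq_slotSum`)

Support file for the crux `PhononStability` (line contragredient-window-collapse), namespace
`…PhononStabilityCWC.Cert`.
-/

noncomputable section

open scoped BigOperators Classical InnerProductSpace
open Filter Set Function
open Summit.AtomisticToContinuum.Crystallization.Theorems.PhononStabilityNegative

namespace Summit.AtomisticToContinuum.Crystallization.Theorems.PhononStabilityCWC.Cert

local notation "E3" => EuclideanSpace ℝ (Fin 3)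

/-! ## Cross-term evaluation is linear in the block matrix; the Gram evaluation regrouped by slot pairs -/

namespace GramP
variable (G : GramP)

/-- cross-term tables evaluate additively in the matrix. [folklore] -/
theorem tpEval_crossTable_add {w : Label → E3} (hw : (support w).Finite) (M N : Mat) (i j : Fin G.S) :
    tpEval (G.crossTable (fun c d => M c d + N c d) i j) w = tpEval (G.crossTable M i j) w + tpEval (G.crossTable N i j) w := by
  rw [← G.cross_eq hw, ← G.cross_eq hw, ← G.cross_eq hw, ← (G.summable_cross hw M i j).tsum_add (G.summable_cross hw N i j)]
  exact tsum_congr fun k => bil_add_left M N _ _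

/-- cross-term tables evaluate homogeneously in the matrix. [folklore] -/
theorem tpEval_crossTable_smul {w : Label → E3} (hw : (support w).Finite) (s : ℚ) (M : Mat) (i j : Fin G.S) :
    tpEval (G.crossTable (fun c d => s * M c d) i j) w = s * tpEval (G.crossTable M i j) w := by
  rw [← G.cross_eq hw, ← G.cross_eq hw, ← tsum_mul_left]
  refine tsum_congr fun k => ?_
  unfold bil
  rw [Finset.mul_sum]
  refine Finset.sum_congr rfl fun c _ => ?_
  rw [Finset.mul_sum]
  refine Finset.sum_congr rfl fun d _ => ?_
  push_cast; ring

/-- the cross-term table of the zero matrix evaluates to zero. [folklore] -/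
theorem tpEval_crossTable_zero {w : Label → E3} (hw : (support w).Finite) (i j : Fin G.S) :
    tpEval (G.crossTable (fun _ _ => 0) i j) w = 0 := by
  rw [← G.cross_eq hw]; simp [bil]

/-- the `(a, b)` table evaluates as the flagged sum of its slot-pair cross terms. [folklore] -/
theorem tpEval_table {w : Label → E3} (hw : (support w).Finite) (a b : Fin G.nmono) :
    tpEval (G.table G.nzTab a b) w = ∑ i : Fin G.S, ∑ j : Fin G.S,
      (if G.nzGet G.nzTab a i && G.nzGet G.nzTab b j then tpEval (G.crossTable (mat9 (G.blockPair a b i j)) i j) w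
        else 0) := by
  unfold table
  rw [tpEval_flatMap, ← List.ofFn_eq_map, List.sum_ofFn]
  refine Finset.sum_congr rfl fun i _ => ?_
  rw [tpEval_flatMap, ← List.ofFn_eq_map, List.sum_ofFn]
  refine Finset.sum_congr rfl fun j _ => ?_
  dsimp only
  split_ifs with hg hz
  · rw [eq_zero_of_matIsZero hz, G.tpEval_crossTable_zero hw]; rfl
  · rfl
  · rfl

/-- **the Gram evaluation regrouped by slot pairs.** [folklore] -/
theorem eval_eq_slotSum {w : Label → E3} (hw : (support w).Finite) (μ : Fin G.nmono → ℝ) :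
    G.eval μ w = ∑ i : Fin G.S, ∑ j : Fin G.S, ∑ a : Fin G.nmono, ∑ b : Fin G.nmono,
      (if G.nzGet G.nzTab a i && G.nzGet G.nzTab b j then
        μ a * μ b * tpEval (G.crossTable (mat9 (G.blockPair a b i j)) i j) w else 0) := by
  rw [G.eval_eq_table hw]
  have h4 : ∀ f : Fin G.nmono → Fin G.nmono → Fin G.S → Fin G.S → ℝ,
      ∑ a, ∑ b, ∑ i, ∑ j, f a b i j = ∑ i, ∑ j, ∑ a, ∑ b, f a b i j := by
    intro f
    calc ∑ a, ∑ b, ∑ i, ∑ j, f a b i j = ∑ a, ∑ i, ∑ b, ∑ j, f a b i j := by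
          refine Finset.sum_congr rfl fun a _ => Finset.sum_comm
      _ = ∑ i, ∑ a, ∑ b, ∑ j, f a b i j := Finset.sum_comm
      _ = ∑ i, ∑ a, ∑ j, ∑ b, f a b i j := by
          refine Finset.sum_congr rfl fun i _ => Finset.sum_congr rfl fun a _ => Finset.sum_comm
      _ = ∑ i, ∑ j, ∑ a, ∑ b, f a b i j := by
          refine Finset.sum_congr rfl fun i _ => Finset.sum_comm
  rw [← h4]
  refine Finset.sum_congr rfl fun a _ => Finset.sum_congr rfl fun b _ => ?_
  rw [G.tpEval_table hw, Finset.mul_sum]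
  refine Finset.sum_congr rfl fun i _ => ?_
  rw [Finset.mul_sum]
  refine Finset.sum_congr rfl fun j _ => ?_
  split_ifs <;> simp

end GramP


/-- Anchor of this support file (registered stub of the line skeleton). -/
theorem stub_certGramSlot : ∀ (G : GramP) (w : Label → EuclideanSpace ℝ (Fin 3)), (Function.support w).Finite →
    ∀ (μ : Fin G.nmono → ℝ), G.eval μ w = ∑ i : Fin G.S, ∑ j : Fin G.S, ∑ a : Fin G.nmono, ∑ b : Fin G.nmono,
      (if G.nzGet G.nzTab a i && G.nzGet G.nzTab b j then
        μ a * μ b * tpEval (G.crossTable (mat9 (G.blockPair a b i j)) i j) w else 0) :=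
  fun G _ hw μ => G.eval_eq_slotSum hw μ

end Summit.AtomisticToContinuum.Crystallization.Theorems.PhononStabilityCWC.Cert

end
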